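import Summits.Ventures.HodgeRepro2.T5Sl2LowestWeight

/-!
# The Casimir element on a lowest-weight `sl₂`-module

Tier-5 support (N4.3 = (R3), step (P2′) «Bargmann's list»; route/T5-SUPPORT-p1.md §S4.16).
Bargmann's classification of the irreducible unitary representations of `SL(2, ℝ)` is
parametrised by the eigenvalue of the Casimir element together with the `K`-types; this file gives
the algebraic fact underneath: on a lowest-weight module the Casimir element acts by the scalar
`μ (μ − 2)` determined by the lowest weight.

* `casimirOf E F H = H² + 2 EF + 2 FE` for elements `E, F, H` of any ring satisfying the `sl₂`
  relations `EF − FE = H`, `HE − EH = 2E`, `HF − FH = −2F`; it commutes with `E`, `F` and `H`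
  (`casimirOf_comm_E`, `casimirOf_comm_F`, `casimirOf_comm_H` — pure ring computations, the
  products being re-ordered by the relations);
* `casimir t : Module.End K M` for an `sl₂`-triple acting on a module: `toEnd_sub_comm` gives the
  relations, so `casimir_comm_e` / `casimir_comm_f` / `casimir_comm_h` hold;
* `casimir_apply_lowest`: on a lowest-weight vector of weight `μ`, `casimir m = μ (μ − 2) • m`;
  `casimir_pow_e`: on the whole e-string; `casimir_eq_smul_id`: on an irreducible lowest-weight
  module (triple spanning, characteristic zero, `μ ∉ −ℕ`) the Casimir element IS the scalar
  `μ (μ − 2)`; for `μ = 3` the scalar is `3` (`casimir_eq_smul_id_of_three`).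

What this file does NOT say: anything about `π₃⁺` as a representation of the group; the
normalisation of the Casimir operator in Bargmann / Lang (a multiple and a shift of this one) is
a convention of the printed source, not re-derived here.

Blind lane: Mathlib + own prefix; no sorry; axioms ⊆ {propext, Classical.choice, Quot.sound}.
-/

namespace Summit.Ventures.HodgeRepro2.T5Sl2Casimir

open LieModule Module Summit.Ventures.HodgeRepro2.T5Sl2LowestWeight

section Ring

variable {A : Type*} [Ring A]

/-- The Casimir element `H² + 2 EF + 2 FE` of a ring-level `sl₂`-triple. -/
def casimirOf (E F H : A) : A := H * H + 2 • (E * F) + 2 • (F * E)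

/-- The re-ordering rules from the `sl₂` relations, in the forms used below. -/
lemma reorder_rules (E F H : A) (hEF : E * F - F * E = H) (hHE : H * E - E * H = 2 • E)
    (hHF : H * F - F * H = -(2 • F)) :
    (H * E = E * H + 2 • E) ∧ (H * F = F * H - 2 • F) ∧ (F * E = E * F - H) ∧
      (∀ Z, H * (E * Z) = E * (H * Z) + 2 • (E * Z)) ∧
      (∀ Z, H * (F * Z) = F * (H * Z) - 2 • (F * Z)) ∧
      (∀ Z, F * (E * Z) = E * (F * Z) - H * Z) := by
  have r1 : H * E = E * H + 2 • E := by rw [← hHE]; abel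
  have r2 : H * F = F * H - 2 • F := by
    calc H * F = (H * F - F * H) + F * H := by abel
      _ = -(2 • F) + F * H := by rw [hHF]
      _ = F * H - 2 • F := by abel
  have r3 : F * E = E * F - H := by rw [← hEF]; abel
  refine ⟨r1, r2, r3, fun Z => ?_, fun Z => ?_, fun Z => ?_⟩
  · rw [← mul_assoc, r1, add_mul, mul_assoc, smul_mul_assoc]
  · rw [← mul_assoc, r2, sub_mul, mul_assoc, smul_mul_assoc]
  · rw [← mul_assoc, r3, sub_mul, mul_assoc]

/-- The Casimir element commutes with `E`. -/
lemma casimirOf_comm_E (E F H : A) (hEF : E * F - F * E = H) (hHE : H * E - E * H = 2 • E)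
    (hHF : H * F - F * H = -(2 • F)) : E * casimirOf E F H = casimirOf E F H * E := by
  obtain ⟨r1, -, r3, r1', -, -⟩ := reorder_rules E F H hEF hHE hHF
  simp only [casimirOf, mul_add, add_mul, mul_sub, sub_mul, mul_smul_comm, smul_mul_assoc,
    mul_assoc, r1, r3, r1', smul_add, smul_sub, smul_smul]
  abel

/-- The Casimir element commutes with `F`. -/
lemma casimirOf_comm_F (E F H : A) (hEF : E * F - F * E = H) (hHE : H * E - E * H = 2 • E)
    (hHF : H * F - F * H = -(2 • F)) : F * casimirOf E F H = casimirOf E F H * F := by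
  obtain ⟨-, r2, r3, -, r2', r3'⟩ := reorder_rules E F H hEF hHE hHF
  simp only [casimirOf, mul_add, add_mul, mul_sub, sub_mul, mul_smul_comm, smul_mul_assoc,
    mul_assoc, r2, r3, r2', r3']
  abel

/-- The Casimir element commutes with `H`. -/
lemma casimirOf_comm_H (E F H : A) (hEF : E * F - F * E = H) (hHE : H * E - E * H = 2 • E)
    (hHF : H * F - F * H = -(2 • F)) : H * casimirOf E F H = casimirOf E F H * H := by
  obtain ⟨-, r2, r3, r1', -, -⟩ := reorder_rules E F H hEF hHE hHF
  simp only [casimirOf, mul_add, add_mul, mul_sub, sub_mul, mul_smul_comm, smul_mul_assoc,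
    mul_assoc, r2, r3, r1', smul_add, smul_sub, smul_smul]
  abel

end Ring

section Module

variable {K L M : Type*} [Field K] [LieRing L] [LieAlgebra K L]
  [AddCommGroup M] [Module K M] [LieRingModule L M] [LieModule K L M]
variable {h e f : L}

/-- `toEnd ⁅x, y⁆ = toEnd x ∘ toEnd y − toEnd y ∘ toEnd x` (as endomorphisms). -/
lemma toEnd_sub_comm (x y : L) :
    toEnd K L M x * toEnd K L M y - toEnd K L M y * toEnd K L M x = toEnd K L M ⁅x, y⁆ := by
  ext v
  simp only [LinearMap.sub_apply, Module.End.mul_apply, toEnd_apply_apply]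
  rw [lie_lie]

/-- The relation `EF − FE = H` for the action of an `sl₂`-triple. -/
lemma toEnd_e_f (t : IsSl2Triple h e f) :
    toEnd K L M e * toEnd K L M f - toEnd K L M f * toEnd K L M e = toEnd K L M h := by
  rw [toEnd_sub_comm, t.lie_e_f]

/-- The relation `HE − EH = 2E` for the action of an `sl₂`-triple. -/
lemma toEnd_h_e (t : IsSl2Triple h e f) :
    toEnd K L M h * toEnd K L M e - toEnd K L M e * toEnd K L M h = 2 • toEnd K L M e := by
  rw [toEnd_sub_comm, t.lie_h_e_nsmul, map_nsmul]

/-- The relation `HF − FH = −2F` for the action of an `sl₂`-triple. -/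
lemma toEnd_h_f (t : IsSl2Triple h e f) :
    toEnd K L M h * toEnd K L M f - toEnd K L M f * toEnd K L M h = -(2 • toEnd K L M f) := by
  rw [toEnd_sub_comm, t.lie_h_f_nsmul, map_neg, map_nsmul]

/-- The Casimir endomorphism `h² + 2 ef + 2 fe` of an `sl₂`-triple acting on `M`. -/
def casimir (_t : IsSl2Triple h e f) : Module.End K M :=
  casimirOf (toEnd K L M e) (toEnd K L M f) (toEnd K L M h)

/-- The Casimir endomorphism commutes with the action of `e`. -/
lemma casimir_comm_e (t : IsSl2Triple h e f) :
    toEnd K L M e * casimir (K := K) (M := M) t = casimir (K := K) (M := M) t * toEnd K L M e :=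
  casimirOf_comm_E _ _ _ (toEnd_e_f t) (toEnd_h_e t) (toEnd_h_f t)

/-- The Casimir endomorphism commutes with the action of `f`. -/
lemma casimir_comm_f (t : IsSl2Triple h e f) :
    toEnd K L M f * casimir (K := K) (M := M) t = casimir (K := K) (M := M) t * toEnd K L M f :=
  casimirOf_comm_F _ _ _ (toEnd_e_f t) (toEnd_h_e t) (toEnd_h_f t)

/-- The Casimir endomorphism commutes with the action of `h`. -/
lemma casimir_comm_h (t : IsSl2Triple h e f) :
    toEnd K L M h * casimir (K := K) (M := M) t = casimir (K := K) (M := M) t * toEnd K L M h :=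
  casimirOf_comm_H _ _ _ (toEnd_e_f t) (toEnd_h_e t) (toEnd_h_f t)

/-- The value of the Casimir endomorphism on a vector: `h (h v) + 2 e (f v) + 2 f (e v)`. -/
lemma casimir_apply (t : IsSl2Triple h e f) (v : M) :
    casimir (K := K) (M := M) t v = ⁅h, ⁅h, v⁆⁆ + 2 • ⁅e, ⁅f, v⁆⁆ + 2 • ⁅f, ⁅e, v⁆⁆ := by
  simp only [casimir, casimirOf, LinearMap.add_apply, LinearMap.smul_apply, Module.End.mul_apply,
    toEnd_apply_apply]

variable {t : IsSl2Triple h e f} {m : M} {μ : K}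

/-- On a lowest-weight vector of weight `μ` the Casimir endomorphism is the scalar `μ (μ − 2)`. -/
theorem casimir_apply_lowest (P : HasLowestWeightVector t m μ) :
    casimir (K := K) (M := M) t m = (μ * (μ - 2)) • m := by
  have hfe : ⁅f, ⁅e, m⁆⁆ = -μ • m := by
    have := P.lie_f_pow_succ 0
    simpa using this
  rw [casimir_apply, P.lie_f, lie_zero, smul_zero, add_zero, P.lie_h, lie_smul, P.lie_h, smul_smul,
    hfe, ← Nat.cast_smul_eq_nsmul K, smul_smul, ← add_smul]
  congr 1
  push_cast
  ring

/-- On the whole e-string: `casimir (eⁿ m) = μ (μ − 2) • eⁿ m`. -/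
theorem casimir_pow_e (P : HasLowestWeightVector t m μ) (n : ℕ) :
    casimir (K := K) (M := M) t ((toEnd K L M e ^ n) m) =
      (μ * (μ - 2)) • (toEnd K L M e ^ n) m := by
  induction n with
  | zero => simpa using casimir_apply_lowest P
  | succ n ih =>
    rw [pow_succ', Module.End.mul_apply, ← Module.End.mul_apply (casimir t), ← casimir_comm_e,
      Module.End.mul_apply, ih, map_smul]

/-- On an irreducible lowest-weight module (triple spanning `L`, characteristic zero, `μ ∉ −ℕ`)
the Casimir endomorphism is the scalar `μ (μ − 2)`. -/
theorem casimir_eq_smul_id [CharZero K] [LieModule.IsIrreducible K L M]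
    (P : HasLowestWeightVector t m μ) (hμ : ∀ n : ℕ, μ ≠ -(n : K))
    (hL : t.toLieSubalgebra K = ⊤) :
    casimir (K := K) (M := M) t = (μ * (μ - 2)) • (1 : Module.End K M) := by
  refine (P.eStringBasis hμ hL).ext fun n => ?_
  rw [HasLowestWeightVector.eStringBasis_apply, casimir_pow_e P n, LinearMap.smul_apply,
    Module.End.one_apply]

/-- Lowest weight `3`: the Casimir scalar is `3`. -/
theorem casimir_eq_smul_id_of_three [CharZero K] [LieModule.IsIrreducible K L M]
    (P : HasLowestWeightVector t m (3 : K)) (hL : t.toLieSubalgebra K = ⊤) :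
    casimir (K := K) (M := M) t = (3 : K) • (1 : Module.End K M) := by
  rw [casimir_eq_smul_id P three_ne_neg hL]
  norm_num

end Module

end Summit.Ventures.HodgeRepro2.T5Sl2Casimir
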